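import Summits.CriticalPhenomena.PercolationContinuityZ3.Theorems.PercNearOneGluingNoHeavyQuantGatedSliceMixLawPooled
import HarnessLib

/-!
# QUANT lane R8, T-DEC, leg (III), blob case — THE KINK-RATIO LEMMA (Φ) of the regime-B mixtures of `GatedSliceMixLaw'`:
# a low's demand on the weak-mid law's mid `h`, converted at `W_h`'s exchange rate, is at most its demand on a higher mid `k`

builds on p205010 (kernel theorem, internal audit signed; external expert review pending)

Support file (`--supports stmt-CriticalPhenomena-4575`), QUANT lane census seat (design 2, gen 61), rung R8 of
`run/shared/lean/prim/quant/LADDER.md`; memo `run/shared/lean/prim/quant/prim-quant-census-2-g61/REGIME-B-TOP-G61.md`.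
One theorem, standard axioms, no sorries, no definitions.

WHERE IT IS USED.  In the mixtures `θ·W_h + (1−θ)·P` of the weak-mid law `W_h = (1−S/h)δ₀ + (S/h)(1−g)δ_h + (S/h)g δ_{h+a}`
with a moved two-point law `P` (cells `MixLawCellBTopBelow`, `…RegimeBTopBelow`; B-L, `…RegimeBTwin`), the kink certificate fills
`W`'s mid `h` with a low of `P` (`θ·(S/h)(1−g) = (1−θ)·D`, `D` the demand on `h`) and pays `W`'s zero deficit
`e' = u(1 − S/h) − (S/h)g` out of `P`'s giant room `R`; it is feasible iff EXACTLY `D·e' ≤ (S/h)(1−g)·R`, i.e.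
`φ·D ≤ R` with `φ = (u(h−S) − Sg)/(S(1−g)) ∈ (0,1)` (`1 − φ = (S − yh)/((1−y)S(1−g))` is the TA slack of `W_h` at `h`).
The lemma bounds `φ·U(l,h)` by `U(l,k)` for any higher mid `k` with `y·k ≤ S`: so a demand routed through `h` at `W_h`'s rate costs no
more than the pooled inequality of `…Pooled` (top `k`) provides — which closes `MixLawCellBTopBelow` but for one thin sub-case
(`…RegimeBTopBelowKink`).  Seat census: all lows, all three status combinations, 4 290 exact instances, worst ratio 0.89.

THE PROOF is three explicit nonnegative certificates (found by hand, checked by `ring`), one per status of `l` at `h` and `k`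
(light at `h` ⟹ light at `k`), in the closed forms `usage_eq_light'` / `usage_eq_heavy'` (`…LightTwoBlobFlow`); the slacks used are
`S − y·k ≥ 0`, `y(k−l) − (t−2l) ≥ 0` or `(t−2l) − y(h−l) ≥ 0` (statuses), `S·g·(1−y) ≥ 0`, `k − h ≥ 0`, and the one genuine
hypothesis `t − S ≤ l` (or, `l` light at `h`, `t − S ≤ l + y(h−l)`): for the shifted low `ℓ = k₁ + a` of the blob case it holds
because `t − S = ag(1−z) ≤ a ≤ ℓ`; for `k₁` light at `h` because `t − 2k₁ ≤ y(h−k₁)` and `k₁ ≤ S`.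

* `LawDec.usage_kink_le` — `(u(h−S) − S·g)·U(l,h) ≤ S(1−g)·U(l,k)`.

[this work].  The gluing rows served [cite: KozmaNitzan2024, Conjecture 3 (p. 15)]; product measure [cite: Grimmett1999, §1.3 p. 10].
-/

noncomputable section

namespace Summit.CriticalPhenomena.PercolationContinuityZ3.Theorems

namespace Quant

open Finset

namespace LawDec

set_option maxHeartbeats 800000 in
/-- **THE KINK-RATIO LEMMA (Φ).**  For a `t`-low `l` compatible with the mid `h`, a higher mid `k > h` with `y·k ≤ S`, and
`t − S ≤ l` (or `l` light at `h` with `t − S ≤ l + y(h−l)`):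
`(u(h−S) − S·g)·U(l,h) ≤ S(1−g)·U(l,k)` (`u = y/(1−y)`, `U = usage y t j`).  Here `u(1 − S/h) − (S/h)g` is the zero deficit and
`(S/h)(1−g)` the mid mass of the weak-mid law `W_h`, so the lemma says: converting the low's demand on `h` into giant demand at
`W_h`'s exchange rate costs at most its demand on `k`.  Proof: explicit nonnegative certificates in the three status cases
(`l` light at both, heavy at `h` and light at `k`, heavy at both), from the closed forms `usage_eq_light'` / `usage_eq_heavy'`. [this work] -/
theorem usage_kink_le (y S g t : ℝ) (j l h k : ℕ) (hy0 : 0 < y) (hy1 : y < 1) (hS0 : 0 ≤ S) (hg0 : 0 ≤ g)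
    (hlow : 2 * (l : ℝ) < t) (hcomph : t < (l : ℝ) + h) (hhk : h < k) (hkj : k ≤ j) (hyk : y * (k : ℝ) ≤ S)
    (hl : t - S ≤ (l : ℝ) ∨ (t - 2 * (l : ℝ) ≤ y * ((h : ℝ) - l) ∧ t - S ≤ (l : ℝ) + y * ((h : ℝ) - l))) :
    (y / (1 - y) * ((h : ℝ) - S) - S * g) * usage y t j l h ≤ S * (1 - g) * usage y t j l k := by
  have h1y : 0 < 1 - y := by linarith
  have hhk' : (h : ℝ) < k := by exact_mod_cast hhk
  have hhj : h ≤ j := le_of_lt (lt_of_lt_of_le hhk hkj)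
  have hlh : (l : ℝ) < h := by linarith
  have hcompk : t < (l : ℝ) + k := by linarith
  have hd : 0 ≤ (k : ℝ) - h := by linarith
  have hs2 : 0 ≤ S - y * (k : ℝ) := by linarith
  have hs4 : 0 ≤ S * g * (1 - y) := mul_nonneg (mul_nonneg hS0 hg0) h1y.le
  have hEh : 0 < (1 - y) * (l : ℝ) + (1 + y) * h - t := by nlinarith
  have hEk : 0 < (1 - y) * (l : ℝ) + (1 + y) * k - t := by nlinarith
  have hNk : 0 ≤ y ^ 2 * ((k : ℝ) - l) + (1 - y) * (t - 2 * (l : ℝ)) := by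
    have : 0 ≤ y ^ 2 * ((k : ℝ) - l) := mul_nonneg (sq_nonneg y) (by linarith)
    nlinarith
  have h1yne : (1 - y) ≠ 0 := h1y.ne'
  -- the zero deficit of `W_h` over `1 - y`
  have hX : y / (1 - y) * ((h : ℝ) - S) - S * g = (y * ((h : ℝ) - S) - S * g * (1 - y)) / (1 - y) := by
    rw [eq_div_iff h1yne]; field_simp
  rw [hX]
  by_cases hLh : t - 2 * (l : ℝ) ≤ y * ((h : ℝ) - l)
  · -- light at `h`, hence light at `k`
    have hLk : t - 2 * (l : ℝ) ≤ y * ((k : ℝ) - l) := by nlinarith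
    have hs1 : 0 ≤ (l : ℝ) + y * ((h : ℝ) - l) - (t - S) := by
      rcases hl with h0 | ⟨_, h1⟩
      · nlinarith
      · linarith
    have hs3 : 0 ≤ y * ((k : ℝ) - l) - (t - 2 * (l : ℝ)) := by linarith
    rw [usage_eq_light' y t j l h hy0 hy1 hhj hlow hcomph hLh, usage_eq_light' y t j l k hy0 hy1 hkj hlow hcompk hLk,
      div_mul_div_comm, ← mul_div_assoc, div_le_div_iff₀ (by positivity) (by positivity)]
    have key : S * (1 - g) * (y ^ 2 * ((k : ℝ) - l) + (1 - y) * (t - 2 * (l : ℝ)))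
          * ((1 - y) * ((1 - y) * ((1 - y) * (l : ℝ) + (1 + y) * h - t)))
        - (y * ((h : ℝ) - S) - S * g * (1 - y)) * (y ^ 2 * ((h : ℝ) - l) + (1 - y) * (t - 2 * (l : ℝ)))
          * ((1 - y) * ((1 - y) * (l : ℝ) + (1 + y) * k - t))
        = (1 - y) * ((S - y * (k : ℝ)) * (y ^ 2 * ((k : ℝ) - l) + (1 - y) * (t - 2 * (l : ℝ))) * ((1 - y) * (l : ℝ) + (1 + y) * h - t)
            + y ^ 2 * ((k : ℝ) - h) * (y * ((k : ℝ) - l) - (t - 2 * (l : ℝ))) * ((1 - y) * (l : ℝ) + (1 + y) * h - t)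
            + (y * ((l : ℝ) + y * ((h : ℝ) - l) - (t - S)) + S * g * (1 - y)) * (t - 2 * (l : ℝ)) * ((k : ℝ) - h)) := by
      ring
    have p1 := mul_nonneg (mul_nonneg hs2 hNk) hEh.le
    have p2 := mul_nonneg (mul_nonneg (mul_nonneg (sq_nonneg y) hd) hs3) hEh.le
    have p3 := mul_nonneg (mul_nonneg (add_nonneg (mul_nonneg hy0.le hs1) hs4) (by linarith : (0 : ℝ) ≤ t - 2 * (l : ℝ))) hd
    have p := mul_nonneg h1y.le (add_nonneg (add_nonneg p1 p2) p3)
    linarith [key, p]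
  · push Not at hLh
    have hs0 : 0 ≤ (l : ℝ) - (t - S) := by
      rcases hl with h0 | ⟨h1, _⟩
      · linarith
      · exact absurd h1 (not_le.2 hLh)
    have hsH : 0 ≤ (t - 2 * (l : ℝ)) - y * ((h : ℝ) - l) := by linarith
    have hden_h : 0 < (l : ℝ) + h - t := by linarith
    rw [usage_eq_heavy' y t j l h hy0 hy1 hhj hlow hcomph hLh.le]
    by_cases hLk : t - 2 * (l : ℝ) ≤ y * ((k : ℝ) - l)
    · -- heavy at `h`, light at `k`
      have hs3 : 0 ≤ y * ((k : ℝ) - l) - (t - 2 * (l : ℝ)) := by linarith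
      rw [usage_eq_light' y t j l k hy0 hy1 hkj hlow hcompk hLk, div_mul_div_comm, ← mul_div_assoc,
        div_le_div_iff₀ (by positivity) (by positivity)]
      have key : S * (1 - g) * (y ^ 2 * ((k : ℝ) - l) + (1 - y) * (t - 2 * (l : ℝ))) * ((1 - y) * ((l : ℝ) + h - t))
          - (y * ((h : ℝ) - S) - S * g * (1 - y)) * (t - 2 * (l : ℝ)) * ((1 - y) * ((1 - y) * (l : ℝ) + (1 + y) * k - t))
          = (S - y * (k : ℝ)) * (y ^ 2 * ((k : ℝ) - l) + (1 - y) * (t - 2 * (l : ℝ))) * ((l : ℝ) + h - t)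
              + y ^ 2 * ((l : ℝ) + h - t) * (y * ((k : ℝ) - l) - (t - 2 * (l : ℝ))) * ((k : ℝ) - l)
              + (y * ((l : ℝ) - (t - S)) + S * g * (1 - y))
                * (((k : ℝ) - l) * ((t - 2 * (l : ℝ)) - y * ((h : ℝ) - l))
                    + (1 - y) * ((h : ℝ) - l) * (y * ((k : ℝ) - l) - (t - 2 * (l : ℝ)))) := by
        ring
      have p1 := mul_nonneg (mul_nonneg hs2 hNk) hden_h.le
      have p2 := mul_nonneg (mul_nonneg (mul_nonneg (sq_nonneg y) hden_h.le) hs3) (by linarith : (0 : ℝ) ≤ (k : ℝ) - l)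
      have hC : 0 ≤ ((k : ℝ) - l) * ((t - 2 * (l : ℝ)) - y * ((h : ℝ) - l))
          + (1 - y) * ((h : ℝ) - l) * (y * ((k : ℝ) - l) - (t - 2 * (l : ℝ))) :=
        add_nonneg (mul_nonneg (by linarith) hsH) (mul_nonneg (mul_nonneg h1y.le (by linarith)) hs3)
      have p3 := mul_nonneg (add_nonneg (mul_nonneg hy0.le hs0) hs4) hC
      linarith [key, p1, p2, p3]
    · -- heavy at both
      push Not at hLk
      have hden_k : 0 < (l : ℝ) + k - t := by linarith
      rw [usage_eq_heavy' y t j l k hy0 hy1 hkj hlow hcompk hLk.le, div_mul_div_comm, ← mul_div_assoc,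
        div_le_div_iff₀ (by positivity) (by positivity)]
      have key : S * (1 - g) * (t - 2 * (l : ℝ)) * ((1 - y) * ((l : ℝ) + h - t))
          - (y * ((h : ℝ) - S) - S * g * (1 - y)) * (t - 2 * (l : ℝ)) * ((l : ℝ) + k - t)
          = (t - 2 * (l : ℝ)) * ((S - y * (k : ℝ)) * ((l : ℝ) + h - t) + ((k : ℝ) - h) * (y * ((l : ℝ) - (t - S)) + S * g * (1 - y))) := by
        ring
      have p1 := mul_nonneg hs2 hden_h.le
      have p2 := mul_nonneg hd (add_nonneg (mul_nonneg hy0.le hs0) hs4)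
      have p := mul_nonneg (by linarith : (0 : ℝ) ≤ t - 2 * (l : ℝ)) (add_nonneg p1 p2)
      linarith [key, p]

end LawDec

end Quant

end Summit.CriticalPhenomena.PercolationContinuityZ3.Theorems
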